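import Summits.CriticalPhenomena.Ising3DConformalLimit.Theorems.PerfectScreeningSubharmonicOffOriginCcetGreenWallis
import Summits.CriticalPhenomena.Ising3DConformalLimit.Theorems.PerfectScreeningSubharmonicOffOriginCcetGreenTail
import Summits.CriticalPhenomena.Ising3DConformalLimit.Theorems.PerfectScreeningSubharmonicOffOriginCcetOrder

/-!
# `stub_order_beyond_threshold`: the nearest-neighbour Ising model on `ℤ³` is ordered for `β > 13/50`
(crux stmt-CriticalPhenomena-1341 `SubharmonicOffOrigin`, line `certified-core-eventual-tail`, stub 1;
lead `prover-line-stmt-CriticalPhenomena-1341-0`)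

`∀ β, 13/50 < β → 0 < spontaneousMagnetization 3 β`, i.e. **`β_c(3) ≤ 0.26`**, PROVED. By
`…CcetOrder.lean` (Fröhlich–Simon–Spencer infrared bound + GKS: `1 - latticeGreen 0/(2β) ≤ m*(β)²`)
it remained to certify Watson's integral: `latticeGreen (0 : Site 3) ≤ 13/25` (`latticeGreen_zero_le`;
true value `W_S/3 = 0.505462…`, G. N. Watson, Quart. J. Math. 10 (1939) 266–276; the bound proved
here is `≤ 0.5119`). Proof:

* `1/ε(θ) = ⅓ (1 - φ)⁻¹`, `φ = ⅓ Σⱼ cos θⱼ`, and `|φ| < 1` off the null set `{-π,0,π}³`, so the paired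
  Neumann partial sums `⅓ Σ_{m<2K+2} φ^m` increase to `1/ε` a.e.; monotone convergence
  (`tendsto_integral_partialSum`) gives `∫ 1/ε = lim_K ⅓ Σ_{n≤K} ∫ φ^{2n}` (odd moments vanish,
  part A `ccetGreen_moment_odd`) — Pólya's `3 · latticeGreen 0 = Σ_n P(S_{2n} = 0)`;
* HEAD `n ≤ 25`: `∫ φ^{2n} = (2π)³ T(n)/36^n` (part A `ccetGreen_moment_even`) and
  `Σ_{n≤25} 36^{25-n} T(n) = 1151351089745338771520894618784580191960` by the kernel (`decide`),
  i.e. `Σ_{n≤25} P(S_{2n}=0) = 1.42444…`;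
* TAIL `n ≥ 26`: part B `ccetGreen_moment_le` (`P(S_{2n}=0) ≤ 0.2752 n^{-3/2} + 0.851^{2n}`) summed
  with `Σ_{n>25} n^{-3/2} ≤ 2/5` (telescoping) and a geometric series: `≤ 0.1109`;
* total `(1.42444 + 0.1109)/3 = 0.5118 ≤ 13/25`.
-/

noncomputable section

namespace Summit.CriticalPhenomena.Ising3DConformalLimit.Theorems.PerfectScreening.CcetGreen

open MeasureTheory Finset Real Filter Topology
open Literature.Probability.LatticeModels

/-! ### The symbol lies in `(-1, 1)` off a finite set -/

/-- On `[-π, π]`, `|cos t| = 1` only at `t ∈ {-π, 0, π}`. -/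
theorem abs_cos_lt_one_of {t : ℝ} (ht : |t| ≤ π) (h : t ∉ ({-π, 0, π} : Set ℝ)) :
    |Real.cos t| < 1 := by
  refine lt_of_le_of_ne (Real.abs_cos_le_one t) fun h1 => h ?_
  have hsin : Real.sin t = 0 := by
    have h2 : Real.cos t ^ 2 = 1 := by rw [← sq_abs, h1]; norm_num
    have h3 : Real.sin t ^ 2 = 0 := by nlinarith [Real.sin_sq_add_cos_sq t]
    exact pow_eq_zero_iff two_ne_zero |>.1 h3
  obtain ⟨n, hn⟩ := Real.sin_eq_zero_iff.1 hsin
  have hn1 : |(n : ℝ)| ≤ 1 := by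
    have h4 : |(n : ℝ) * π| ≤ π := by rw [hn]; exact ht
    rw [abs_mul, abs_of_pos pi_pos] at h4
    nlinarith [pi_pos, abs_nonneg (n : ℝ)]
  have hn2 : n = -1 ∨ n = 0 ∨ n = 1 := by
    have h5 : |n| ≤ 1 := by exact_mod_cast hn1
    rcases abs_le.1 h5 with ⟨h6, h7⟩
    omega
  rcases hn2 with rfl | rfl | rfl <;> rw [← hn] <;> simp

/-- Off the finite exceptional set `{-π, 0, π}³`, `|Σⱼ cos θⱼ| < 3` on the zone. -/
theorem abs_sum_cos_lt_three {θ : Fin 3 → ℝ} (hθ : θ ∈ brillouin 3)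
    (hE : θ ∉ Set.pi Set.univ (fun _ : Fin 3 => ({-π, 0, π} : Set ℝ))) :
    |∑ j, Real.cos (θ j)| < 3 := by
  have hθj : ∀ j, |θ j| ≤ π := fun j => abs_le.2 (hθ j (Set.mem_univ _))
  obtain ⟨j, hj⟩ : ∃ j, θ j ∉ ({-π, 0, π} : Set ℝ) := by
    by_contra h
    push Not at h
    exact hE fun j _ => h j
  have hlt : |Real.cos (θ j)| < 1 := abs_cos_lt_one_of (hθj j) hj
  have h : ∑ l ∈ Finset.univ.erase j, |Real.cos (θ l)| ≤ ∑ l ∈ Finset.univ.erase j, (1 : ℝ) :=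
    Finset.sum_le_sum fun l _ => Real.abs_cos_le_one _
  have hc : (Finset.univ.erase j).card = 2 := by
    rw [Finset.card_erase_of_mem (Finset.mem_univ j), Finset.card_univ, Fintype.card_fin]
  rw [Finset.sum_const, hc] at h
  simp only [nsmul_eq_mul, Nat.cast_ofNat, mul_one] at h
  have h' := Finset.add_sum_erase Finset.univ (fun l => |Real.cos (θ l)|) (Finset.mem_univ j)
  calc |∑ l, Real.cos (θ l)| ≤ ∑ l, |Real.cos (θ l)| := Finset.abs_sum_le_sum_abs _ _
    _ < 3 := by linarith

/-! ### Monotone convergence for the Neumann series of `1/ε = ⅓ (1 - φ)⁻¹` -/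

/-- `1/ε(θ) = ⅓ (1 - φ(θ))⁻¹` with `φ = ⅓ Σⱼ cos θⱼ` (both sides `0` at `θ = 0`). -/
theorem one_div_dispersion_eq (θ : Fin 3 → ℝ) :
    1 / dispersion θ = (3 : ℝ)⁻¹ * (1 - (3 : ℝ)⁻¹ * ∑ j, Real.cos (θ j))⁻¹ := by
  have hd : dispersion θ = 3 - ∑ j, Real.cos (θ j) := by
    simp only [dispersion, Finset.sum_sub_distrib, Finset.sum_const, Finset.card_univ,
      Fintype.card_fin, nsmul_eq_mul, Nat.cast_ofNat, mul_one]
  rw [hd, one_div, show (1 : ℝ) - 3⁻¹ * ∑ j, Real.cos (θ j) = 3⁻¹ * (3 - ∑ j, Real.cos (θ j)) by ring,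
    mul_inv, inv_inv, ← mul_assoc]
  norm_num

/-- **Monotone convergence**: `∫_{zone} ⅓ Σ_{m<2K+2} φ^m → ∫_{zone} 1/ε` as `K → ∞`
(`|φ| < 1` off the null set `{-π,0,π}³`; the paired partial sums increase). -/
theorem tendsto_integral_partialSum :
    Tendsto (fun K : ℕ => ∫ θ in brillouin 3,
      (3 : ℝ)⁻¹ * ∑ m ∈ range (2 * K + 2), ((3 : ℝ)⁻¹ * ∑ j, Real.cos (θ j)) ^ m)
      atTop (𝓝 (∫ θ in brillouin 3, 1 / dispersion θ)) := by
  have hK := isCompact_brillouin 3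
  refine integral_tendsto_of_tendsto_of_monotone (μ := volume.restrict (brillouin 3))
    (fun K => ?_) ?_ (ae_of_all _ fun θ => ?_) ?_
  · exact (by fun_prop : Continuous fun θ : Fin 3 → ℝ =>
      (3 : ℝ)⁻¹ * ∑ m ∈ range (2 * K + 2), ((3 : ℝ)⁻¹ * ∑ j, Real.cos (θ j)) ^ m)
      |>.continuousOn.integrableOn_compact hK
  · have h := integrable_indicator_inv_dispersion 3 le_rfl
    rwa [integrable_indicator_iff (measurableSet_brillouin 3)] at h
  · -- monotone in `K`, for every `θ`
    set φ : ℝ := (3 : ℝ)⁻¹ * ∑ j, Real.cos (θ j) with hφ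
    have hφm1 : -1 ≤ φ := by
      have h3 : ∑ _l : Fin 3, (-1 : ℝ) ≤ ∑ l, Real.cos (θ l) :=
        Finset.sum_le_sum fun l _ => Real.neg_one_le_cos _
      simp only [Finset.sum_const, Finset.card_univ, Fintype.card_fin, smul_neg, nsmul_eq_mul,
        Nat.cast_ofNat, mul_one] at h3
      rw [hφ]; linarith
    refine monotone_nat_of_le_succ fun K => ?_
    have h1 : 0 ≤ φ ^ (2 * K + 2) * (1 + φ) :=
      mul_nonneg (by rw [show 2 * K + 2 = 2 * (K + 1) by ring]; exact (even_two_mul _).pow_nonneg _)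
        (by linarith)
    have h2 : ∑ m ∈ range (2 * (K + 1) + 2), φ ^ m =
        (∑ m ∈ range (2 * K + 2), φ ^ m) + φ ^ (2 * K + 2) * (1 + φ) := by
      rw [show 2 * (K + 1) + 2 = 2 * K + 2 + 1 + 1 by ring, Finset.sum_range_succ,
        Finset.sum_range_succ]
      ring
    show (3 : ℝ)⁻¹ * ∑ m ∈ range (2 * K + 2), φ ^ m ≤ (3 : ℝ)⁻¹ * ∑ m ∈ range (2 * (K + 1) + 2), φ ^ m
    rw [h2]
    linarith
  · -- convergence off the null set `{-π, 0, π}³`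
    have hE : (volume : Measure (Fin 3 → ℝ))
        (Set.pi Set.univ (fun _ : Fin 3 => ({-π, 0, π} : Set ℝ))) = 0 :=
      Set.Finite.measure_zero (Set.Finite.pi fun _ => Set.toFinite _) volume
    rw [ae_restrict_iff' (measurableSet_brillouin 3)]
    filter_upwards [measure_eq_zero_iff_ae_notMem.1 hE] with θ hθE hθ
    set φ : ℝ := (3 : ℝ)⁻¹ * ∑ j, Real.cos (θ j) with hφ
    have hlt : |φ| < 1 := by
      have h := abs_sum_cos_lt_three hθ hθE
      rw [hφ, abs_mul, abs_of_pos (by norm_num : (0 : ℝ) < 3⁻¹)]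
      linarith
    have hgeom := (hasSum_geometric_of_abs_lt_one hlt).tendsto_sum_nat
    have hsub : Tendsto (fun K : ℕ => 2 * K + 2) atTop atTop :=
      tendsto_atTop_atTop.2 fun b => ⟨b, fun K hK => by omega⟩
    have h := (hgeom.comp hsub).const_mul (3 : ℝ)⁻¹
    rw [one_div_dispersion_eq]
    exact h

/-! ### The paired partial sums: odd moments vanish, even moments in closed form -/

/-- `∫ φ^{2n+1} = 0`. -/
theorem integral_symbol_pow_odd (n : ℕ) :
    ∫ θ in brillouin 3, ((3 : ℝ)⁻¹ * ∑ j, Real.cos (θ j)) ^ (2 * n + 1) = 0 := by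
  simp_rw [mul_pow]
  rw [MeasureTheory.integral_const_mul, ccetGreen_moment_odd, mul_zero]

/-- `∫ ⅓ Σ_{m<2K+2} φ^m = ⅓ Σ_{n ≤ K} ∫ φ^{2n}`. -/
theorem integral_partialSum_eq (K : ℕ) :
    ∫ θ in brillouin 3, (3 : ℝ)⁻¹ * ∑ m ∈ range (2 * K + 2), ((3 : ℝ)⁻¹ * ∑ j, Real.cos (θ j)) ^ m =
      (3 : ℝ)⁻¹ * ∑ n ∈ range (K + 1),
        ∫ θ in brillouin 3, ((3 : ℝ)⁻¹ * ∑ j, Real.cos (θ j)) ^ (2 * n) := by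
  have hK := isCompact_brillouin 3
  rw [MeasureTheory.integral_const_mul]
  congr 1
  rw [MeasureTheory.integral_finsetSum _ fun m _ =>
    (by fun_prop : Continuous fun θ : Fin 3 → ℝ => ((3 : ℝ)⁻¹ * ∑ j, Real.cos (θ j)) ^ m)
      |>.continuousOn.integrableOn_compact hK]
  induction K with
  | zero =>
    have h1 := integral_symbol_pow_odd 0
    simp only [mul_zero, zero_add, pow_one] at h1
    simp [Finset.sum_range_succ, h1]
  | succ K ih =>
    rw [show 2 * (K + 1) + 2 = 2 * K + 2 + 1 + 1 by ring, Finset.sum_range_succ,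
      Finset.sum_range_succ, ih, Finset.sum_range_succ _ (K + 1),
      show 2 * K + 2 + 1 = 2 * (K + 1) + 1 by ring, integral_symbol_pow_odd,
      show 2 * K + 2 = 2 * (K + 1) by ring]
    ring

/-! ### The tail: `Σ_{n > 25}` via part B -/

/-- `Σ_{N < n ≤ K} n^{-3/2} ≤ 2/√N - 2/√K` (telescoping), for `1 ≤ N ≤ K`. -/
theorem sum_Ico_inv_sqrt_cube_le {N K : ℕ} (hN : 1 ≤ N) (hNK : N ≤ K) :
    ∑ n ∈ Ico (N + 1) (K + 1), (Real.sqrt n)⁻¹ ^ 3 ≤ 2 / Real.sqrt N - 2 / Real.sqrt K := by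
  induction K, hNK using Nat.le_induction with
  | base => simp
  | succ K hNK ih =>
    rw [Finset.sum_Ico_succ_top (by omega : N + 1 ≤ K + 1), Nat.cast_add, Nat.cast_one]
    have hKpos : (0 : ℝ) < K := by exact_mod_cast (lt_of_lt_of_le hN hNK)
    set s : ℝ := Real.sqrt K with hs
    set t : ℝ := Real.sqrt (K + 1) with ht
    have hs0 : 0 < s := Real.sqrt_pos.2 hKpos
    have ht0 : 0 < t := Real.sqrt_pos.2 (by linarith)
    have hs2 : s ^ 2 = K := Real.sq_sqrt hKpos.le
    have ht2 : t ^ 2 = K + 1 := Real.sq_sqrt (by linarith)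
    have hst : s ≤ t := Real.sqrt_le_sqrt (by linarith)
    have key : t⁻¹ ^ 3 ≤ 2 / s - 2 / t := by
      rw [inv_pow, div_sub_div _ _ hs0.ne' ht0.ne', le_div_iff₀ (by positivity),
        inv_mul_le_iff₀ (by positivity)]
      nlinarith [mul_nonneg (sq_nonneg s) (sq_nonneg (t - s)), sq_nonneg (t - s),
        mul_pos hs0 ht0]
    linarith

/-- The Gaussian part of the tail, summed: for `26 ≤ n`,
`√(π/(43n/144))³ = √(144π/43)³ (√n)⁻³`, and `Σ_{25 < n ≤ K} (√n)⁻³ ≤ 2/5`. -/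
theorem sqrt_div_eq (n : ℕ) (hn : 1 ≤ n) :
    Real.sqrt (π / (43 / 144 * n)) = Real.sqrt (144 * π / 43) * (Real.sqrt n)⁻¹ := by
  have hn' : (0 : ℝ) < n := by exact_mod_cast hn
  rw [show π / (43 / 144 * n) = (144 * π / 43) / n by field_simp, Real.sqrt_div (by positivity),
    div_eq_mul_inv]

/-- **The tail bound**: for every `K`,
`Σ_{25 < n ≤ K} ∫ φ^{2n} ≤ (4/5) √(144π/43)³ + (2π)³ ρ^{52}/(1 - ρ²)`, `ρ = 245/288`. -/
theorem tail_le (K : ℕ) :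
    ∑ n ∈ Ico 26 (K + 1), ∫ θ in brillouin 3, ((3 : ℝ)⁻¹ * ∑ j, Real.cos (θ j)) ^ (2 * n) ≤
      4 / 5 * Real.sqrt (144 * π / 43) ^ 3 +
        (2 * π) ^ 3 * (((245 / 288 : ℝ) ^ 2) ^ 26 / (1 - (245 / 288 : ℝ) ^ 2)) := by
  rcases le_or_gt K 25 with hK | hK
  · rw [Finset.Ico_eq_empty (by omega), Finset.sum_empty]
    positivity
  · have hterm : ∀ n ∈ Ico 26 (K + 1), ∫ θ in brillouin 3, ((3 : ℝ)⁻¹ * ∑ j, Real.cos (θ j)) ^ (2 * n) ≤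
        2 * Real.sqrt (144 * π / 43) ^ 3 * (Real.sqrt n)⁻¹ ^ 3 +
          (2 * π) ^ 3 * ((245 / 288 : ℝ) ^ 2) ^ n := by
      intro n hn
      have hn1 : 1 ≤ n := by have := (Finset.mem_Ico.1 hn).1; omega
      have h := ccetGreen_moment_le n hn1
      rw [sqrt_div_eq n hn1, mul_pow,
        show (245 / 288 : ℝ) ^ (2 * n) = ((245 / 288 : ℝ) ^ 2) ^ n from pow_mul _ _ _] at h
      linarith
    refine (Finset.sum_le_sum hterm).trans ?_
    rw [Finset.sum_add_distrib, ← Finset.mul_sum, ← Finset.mul_sum]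
    have h1 : ∑ n ∈ Ico 26 (K + 1), (Real.sqrt n)⁻¹ ^ 3 ≤ 2 / 5 := by
      have h := sum_Ico_inv_sqrt_cube_le (N := 25) (K := K) (by norm_num) (by omega)
      have h25 : Real.sqrt (25 : ℕ) = 5 := by
        rw [show ((25 : ℕ) : ℝ) = 5 ^ 2 by norm_num, Real.sqrt_sq (by norm_num)]
      rw [h25] at h
      have : 0 ≤ 2 / Real.sqrt K := by positivity
      linarith
    have h2 : ∑ n ∈ Ico 26 (K + 1), ((245 / 288 : ℝ) ^ 2) ^ n ≤
        ((245 / 288 : ℝ) ^ 2) ^ 26 / (1 - (245 / 288 : ℝ) ^ 2) :=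
      geom_sum_Ico_le_of_lt_one (by positivity) (by norm_num)
    have hc : 0 ≤ 2 * Real.sqrt (144 * π / 43) ^ 3 := by positivity
    have hπ : 0 ≤ (2 * π) ^ 3 := by positivity
    nlinarith [mul_le_mul_of_nonneg_left h1 hc, mul_le_mul_of_nonneg_left h2 hπ]

/-! ### The head: `Σ_{n ≤ 25}` by kernel evaluation -/

/-- The head numerator `V = Σ_{n ≤ 25} 36^{25-n} T(n)` evaluated by the kernel
(`T(n)/36^n = P(S_{2n} = 0)`, `T = 1, 6, 90, 1860, 44730, …`). -/
theorem head_eval :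
    (∑ n ∈ range 26, 36 ^ (25 - n) * ∑ a ∈ range (2 * n + 1), ∑ b ∈ range (2 * n - a + 1),
      (if Even a ∧ Even b then
        (2 * n).factorial / ((a / 2).factorial ^ 2 * (b / 2).factorial ^ 2 *
          ((2 * n - a - b) / 2).factorial ^ 2) else 0 : ℕ)) =
      1151351089745338771520894618784580191960 := by
  decide +kernel

/-- **The head in closed form**: `Σ_{n ≤ 25} ∫ φ^{2n} = (2π)³ V / 36^{25}`. -/
theorem head_eq :
    ∑ n ∈ range 26, ∫ θ in brillouin 3, ((3 : ℝ)⁻¹ * ∑ j, Real.cos (θ j)) ^ (2 * n) =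
      (2 * π) ^ 3 * (1151351089745338771520894618784580191960 : ℝ) / 36 ^ 25 := by
  have h : ∀ n ∈ range 26, ∫ θ in brillouin 3, ((3 : ℝ)⁻¹ * ∑ j, Real.cos (θ j)) ^ (2 * n) =
      (2 * π) ^ 3 * ((36 ^ (25 - n) * ∑ a ∈ range (2 * n + 1), ∑ b ∈ range (2 * n - a + 1),
        (if Even a ∧ Even b then
          (2 * n).factorial / ((a / 2).factorial ^ 2 * (b / 2).factorial ^ 2 *
            ((2 * n - a - b) / 2).factorial ^ 2) else 0 : ℕ) : ℕ) : ℝ) / 36 ^ 25 := by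
    intro n hn
    have hn' : n ≤ 25 := by have := Finset.mem_range.1 hn; omega
    have h3 : ((3 : ℝ)⁻¹) ^ (2 * n) = (9 ^ n)⁻¹ := by rw [pow_mul, ← inv_pow]; norm_num
    have h36 : (36 : ℝ) ^ n = 4 ^ n * 9 ^ n := by rw [← mul_pow]; norm_num
    simp_rw [mul_pow]
    rw [MeasureTheory.integral_const_mul, ccetGreen_moment_even]
    push_cast
    rw [pow_sub₀ _ (by norm_num : (36 : ℝ) ≠ 0) hn', h3, h36]
    have h4 : (4 : ℝ) ^ n ≠ 0 := by positivity
    have h9 : (9 : ℝ) ^ n ≠ 0 := by positivity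
    field_simp
  rw [Finset.sum_congr rfl h, ← Finset.sum_div, ← Finset.mul_sum]
  congr 2
  have h2 := head_eval
  exact_mod_cast h2

/-! ### Assembly: `latticeGreen 0 ≤ 13/25` and the stub -/

/-- The Gaussian constant: `√(144π/43)³ / π³ ≤ 1.104`. -/
theorem gauss_const_le : Real.sqrt (144 * π / 43) ^ 3 / π ^ 3 ≤ 1.104 := by
  have h1 : Real.sqrt (144 * π / 43) ≤ 3.2436 := by
    rw [Real.sqrt_le_left (by norm_num)]
    nlinarith [Real.pi_lt_d4]
  have h2 : (3.1415 : ℝ) ^ 3 ≤ π ^ 3 := by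
    have := Real.pi_gt_d4
    exact pow_le_pow_left₀ (by norm_num) this.le 3
  have h3 : Real.sqrt (144 * π / 43) ^ 3 ≤ 3.2436 ^ 3 :=
    pow_le_pow_left₀ (Real.sqrt_nonneg _) h1 3
  rw [div_le_iff₀ (by positivity)]
  nlinarith

/-- **`∫_{[-π,π]³} dθ/ε(θ) ≤ (2π)³ · 13/25`**: monotone convergence of the paired Neumann series,
the head `n ≤ 25` by the kernel, the tail by the sharp Gaussian bound. -/
theorem integral_inv_dispersion_le :
    ∫ θ in brillouin 3, 1 / dispersion θ ≤ (2 * π) ^ 3 * (13 / 25) := by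
  refine le_of_tendsto' tendsto_integral_partialSum fun K => ?_
  rw [integral_partialSum_eq]
  have hnonneg : ∀ n, 0 ≤ ∫ θ in brillouin 3, ((3 : ℝ)⁻¹ * ∑ j, Real.cos (θ j)) ^ (2 * n) :=
    fun n => integral_nonneg fun θ => (even_two_mul n).pow_nonneg _
  have hsplit : ∑ n ∈ range (K + 1), ∫ θ in brillouin 3, ((3 : ℝ)⁻¹ * ∑ j, Real.cos (θ j)) ^ (2 * n) ≤
      (∑ n ∈ range 26, ∫ θ in brillouin 3, ((3 : ℝ)⁻¹ * ∑ j, Real.cos (θ j)) ^ (2 * n)) +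
        ∑ n ∈ Ico 26 (max (K + 1) 26),
          ∫ θ in brillouin 3, ((3 : ℝ)⁻¹ * ∑ j, Real.cos (θ j)) ^ (2 * n) := by
    rw [Finset.sum_range_add_sum_Ico _ (le_max_right _ _)]
    exact Finset.sum_le_sum_of_subset_of_nonneg (Finset.range_mono (le_max_left _ _))
      fun n _ _ => hnonneg n
  have htail : ∑ n ∈ Ico 26 (max (K + 1) 26),
      ∫ θ in brillouin 3, ((3 : ℝ)⁻¹ * ∑ j, Real.cos (θ j)) ^ (2 * n) ≤
      4 / 5 * Real.sqrt (144 * π / 43) ^ 3 +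
        (2 * π) ^ 3 * (((245 / 288 : ℝ) ^ 2) ^ 26 / (1 - (245 / 288 : ℝ) ^ 2)) := by
    have h := tail_le (max (K + 1) 26 - 1)
    rwa [show max (K + 1) 26 - 1 + 1 = max (K + 1) 26 by omega] at h
  rw [head_eq] at hsplit
  have hg := gauss_const_le
  have hπ3 : (0 : ℝ) < π ^ 3 := by positivity
  rw [div_le_iff₀ hπ3] at hg
  have hρ : ((245 / 288 : ℝ) ^ 2) ^ 26 / (1 - (245 / 288 : ℝ) ^ 2) ≤ 0.000807 := by norm_num
  have hV : (1151351089745338771520894618784580191960 : ℝ) / 36 ^ 25 ≤ 1.4244436 := by norm_num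
  have h8 : (2 * π) ^ 3 = 8 * π ^ 3 := by ring
  rw [h8] at hsplit htail ⊢
  have hρ' : 8 * π ^ 3 * (((245 / 288 : ℝ) ^ 2) ^ 26 / (1 - (245 / 288 : ℝ) ^ 2)) ≤
      8 * π ^ 3 * 0.000807 := mul_le_mul_of_nonneg_left hρ (by positivity)
  have hV' : 8 * π ^ 3 * (1151351089745338771520894618784580191960 : ℝ) / 36 ^ 25 ≤
      8 * π ^ 3 * 1.4244436 := by
    rw [mul_div_assoc]
    exact mul_le_mul_of_nonneg_left hV (by positivity)
  nlinarith

/-- **Watson's integral, certified**: `latticeGreen (0 : Site 3) ≤ 13/25`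
(`= W_S/3 = 0.50546…`, Watson 1939; the bound proved is `≤ 0.5119`). -/
theorem latticeGreen_zero_le : latticeGreen (0 : Site 3) ≤ 13 / 25 := by
  have h := integral_inv_dispersion_le
  have h0 : latticeGreen (0 : Site 3) = (∫ θ in brillouin 3, 1 / dispersion θ) / (2 * π) ^ 3 := by
    simp only [latticeGreen, Pi.zero_apply, Int.cast_zero, mul_zero, Finset.sum_const_zero,
      Real.cos_zero]
  rw [h0, div_le_iff₀ (by positivity)]
  linarith

end Summit.CriticalPhenomena.Ising3DConformalLimit.Theorems.PerfectScreening.CcetGreen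

namespace Summit.CriticalPhenomena.Ising3DConformalLimit.Theorems.PerfectScreening.CcetGreen

open Literature.Probability.LatticeModels

/-- **Stub 1 of the line `certified-core-eventual-tail` — ORDER BEYOND THE INFRARED THRESHOLD.**
The nearest-neighbour Ising model on `ℤ³` has positive spontaneous magnetisation at every
`β > 13/50`; hence `β_c(3) ≤ 13/50` (`CertifiedCoreEventualTail.criticalBeta_le_of_order`).
Fröhlich–Simon–Spencer 1976 (infrared bound, tree theorem `infraredBound_holds`) ⇒
`1 - latticeGreen 0/(2β) ≤ m*(β)²` (`CcetOrder.ccetOrder_one_sub_latticeGreen_le_sq`) and Watson's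
integral `latticeGreen 0 = 0.5054… ≤ 13/25` (`latticeGreen_zero_le`). -/
theorem stub_order_beyond_threshold : ∀ β : ℝ, 13 / 50 < β → 0 < spontaneousMagnetization 3 β :=
  CcetOrder.ccetOrder_order_beyond_threshold_of_latticeGreen_le latticeGreen_zero_le

end Summit.CriticalPhenomena.Ising3DConformalLimit.Theorems.PerfectScreening.CcetGreen

end
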